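import Summits.ResolutionOfSingularities.ResolutionOfSingularities.Theorems.HilbertSamuelEliminationSigmaMaxModificationsCorridor3SigmaBirthDictionary3
import Summits.ResolutionOfSingularities.ResolutionOfSingularities.Theorems.HilbertSamuelEliminationSigmaMaxModificationsCorridor3SigmaCyclePlusBoundaryPackage
import HarnessLib

/-!
# [OURS · L1 W4.2] σ-LAYER (E3) — `Corridor3SigmaBirthAges`: the boundary-corner size and the AGES of its members ALONG A RUN
# (the no-triple clause run-wise; the «descent datum»: members older than a stage can only be lost; «FULL → off-skeleton → FULL consumes the two oldest»)

Additive sibling of `…Corridor3SigmaBirthDictionary3` (res-type-067 g12; res-L1-w42-plan-1 RULING v3.14-17 (FA) + GO 12:22:26Z «(T2)-support CELL-GRAPH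
DESCENT DATUM»; res-type-053 READER'S WORD 12:26:28Z (N2)). OURS (cell res-hironaka, slot W4.2); NOT statements of H. Hironaka's manuscript [Hironaka2017]
nor of [CossartJannsenSaito2020]; AI-typed, weaker than expert review. Helper VOCABULARY + proved bookkeeping, `--supports stmt-ResolutionOfSingularities-19249
--as helper` (counted 0); NO row is claimed. Fact-free.

* §6 THE NO-TRIPLE CLAUSE ALONG A RUN: `StrategyE.RespectsNoTripleOn 𝒮 N ν σ` (an SNC-type EMPTINESS discipline, independent of the finiteness clauses
  `PairsMeetNewFinite`/`TripleMeetsFinite`), `CanonicalNearStepσE.cornerSize_le_three`, `ReachesσE.cornerSize_le_three`, **`InScopeMσE.cornerSize_le_three`**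
  (from a maximal origin, `E₀ = []`: at most three members through the marked point, ever).
* §7 AGES = list positions (`Boundary.next` keeps old positions, appends the newest; «members older than stage n₀» at stage m = `E_m.take |E_{n₀}|`):
  `cornerSize_eq_take_add_drop`, `cornerSize_take_next_le`, `CanonicalNearStepσE.cornerSize_take_le` (040's `CanonicalNearStepσE.length_E`, p526345, by import), `ReachesσE.length_E_le/.cornerSize_take_le`
  (the number of members OLDER than any fixed stage through the marked point NEVER INCREASES), and the forbidden combination
  **`ReachesσE.two_le_cornerSize_drop_of_offSkeleton`**: after an off-skeleton birth (marked point on the newest member with ≤ 1 older member through it) at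
  most ONE member older than the birth survives in any later corner, so a re-completed FULL corner holds ≥ 2 members born at or after the birth (the earliest
  re-completion is the next step, at a fixed point over the birth point).
* §8 (rev 2; RULING v3.14-23 (G3)): WHERE A FULL CORNER CAN BE BORN — `not_isFullCorner_next_of_cornerSize_le_one`,
  `oldThrough_eq_membersThrough_of_isFullCorner_next`, **`no_fullCorner_birth_over_of_missed`** (the by-name (G3′) for faces containing both members through
  a pair point), `CanonicalNearStepσE.not_isFullCorner_of_missed`; the `|R ∩ B(x)| = 1` crossing births stay OPEN (prose, toric witness).
-/

noncomputable section

set_option linter.dupNamespace false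

open CategoryTheory AlgebraicGeometry TopologicalSpace
open Summit.ResolutionOfSingularities.ResolutionOfSingularities.Theorems.CampaignW42
open Literature.AlgebraicGeometry.Resolution Literature.RingTheory.HilbertSamuel

namespace Summit.ResolutionOfSingularities.ResolutionOfSingularities.Theorems.SigmaMaxModificationsCorridor3.Sigma

universe u

variable {W : Scheme.{u}}

/-! ## §6 (053 (N2)). THE NO-TRIPLE CLAUSE ALONG A RUN: at most three members through the marked point, ever -/

/-- [OURS · L1 W4.2] **σ RESPECTS THE NO-TRIPLE CLAUSE ON THE SCOPE `𝒮`**: every step σ allows from a state in `𝒮` has a centre `C` with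
`E.NoTripleOnNew C` (an SNC-type EMPTINESS discipline, independent of the finiteness clauses `PairsMeetNewFinite`/`TripleMeetsFinite`; automatic for
snc boundaries met normally — 040/o1 discharge it on the run-wise scope). NOT a statement of the manuscript. [folklore] -/
def StrategyE.RespectsNoTripleOn
    (𝒮 : ∀ (W : Scheme.{u}), IsLocallyNoetherian W → Labelling W → Option (Pending W) → Boundary W → Prop)
    (N : ℕ) (ν : ℕ → ℕ) (σ : StrategyE.{u}) : Prop :=
  ∀ (W : Scheme.{u}) (hW : IsLocallyNoetherian W) (L : Labelling W) (P : Option (Pending W)) (E : Boundary W), 𝒮 W hW L P E →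
    ∀ (C : W.IdealSheafData) (P' : Option (Pending (blowup C))), σ.step W hW N ν L P E C P' → E.NoTripleOnNew C

/-- **ONE STEP**: under the no-triple clause at the state stepped from, `|B(x_{n+1})| ≤ 3` as soon as `|B(x_n)| ≤ 3` (off the new member the size does
not grow; on it, at most two old members plus the new one). [folklore] -/
theorem CanonicalNearStepσE.cornerSize_le_three {σ : StrategyE.{u}} {N : ℕ} {ν : ℕ → ℕ}
    {𝒮 : ∀ (W : Scheme.{u}), IsLocallyNoetherian W → Labelling W → Option (Pending W) → Boundary W → Prop}
    (hσ : σ.RespectsNoTripleOn 𝒮 N ν) {s s' : MarkedStageE.{u}} (h : CanonicalNearStepσE σ N ν s s')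
    (hs : 𝒮 s.W s.ln s.L s.P s.E) (h3 : cornerSize s.E s.pt ≤ 3) : cornerSize s'.E s'.pt ≤ 3 := by
  obtain ⟨C, P', hln, x', hstep, hπ, -, -, rfl⟩ := h
  haveI := s.ln
  by_cases hx : x' ∈ ((C.comap (blowup.π C)).support : Set ↥(blowup C))
  · exact cornerSize_next_le_three (hσ s.W s.ln s.L s.P s.E hs C P' hstep) hx
  · have := cornerSize_next_of_not_mem s.E C hx
    rw [hπ] at this
    exact this.trans h3

/-- **ALONG A RUN**: from a stage with `|B| ≤ 3` at the marked point, a strategy respecting the no-triple clause on a scope containing the reached states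
keeps `|B(x_n)| ≤ 3`. [folklore] -/
theorem ReachesσE.cornerSize_le_three {σ : StrategyE.{u}} {N : ℕ} {ν : ℕ → ℕ}
    {𝒮 : ∀ (W : Scheme.{u}), IsLocallyNoetherian W → Labelling W → Option (Pending W) → Boundary W → Prop}
    (hσ : σ.RespectsNoTripleOn 𝒮 N ν) {s₀ s : MarkedStageE.{u}} (h : ReachesσE σ N ν s₀ s)
    (hscope : ∀ t : MarkedStageE.{u}, ReachesσE σ N ν s₀ t → 𝒮 t.W t.ln t.L t.P t.E) (h0 : cornerSize s₀.E s₀.pt ≤ 3) :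
    cornerSize s.E s.pt ≤ 3 := by
  induction h with
  | refl => exact h0
  | tail hreach hlast ih => exact hlast.cornerSize_le_three hσ (hscope _ hreach) ih

/-- **FROM A MAXIMAL ORIGIN (`E₀ = []`)**: at most three boundary members through the marked point at every stage in scope. [folklore] -/
theorem InScopeMσE.cornerSize_le_three {p : ℕ} {σ : StrategyE.{u}} {N : ℕ} {ν : ℕ → ℕ}
    (hσ : σ.RespectsNoTripleOn (StrategyE.ReachableState p σ N ν fun _ _ => []) N ν) {s : MarkedStageE.{u}}
    (h : InScopeMσE p σ N ν (fun _ _ => []) s) : cornerSize s.E s.pt ≤ 3 := by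
  obtain ⟨X, hX, x, horig, hreach⟩ := h
  refine hreach.cornerSize_le_three hσ (fun t ht => ⟨t.pt, X, hX, x, horig, ht⟩) ?_
  show cornerSize ([] : Boundary X) x ≤ 3
  rw [cornerSize_nil]; exact Nat.zero_le _

/-! ## §7 (plan-1 GO 12:22:26Z «(T2)-support CELL-GRAPH DESCENT DATUM»). AGES: the members OLDER than a given stage through the marked
point can only be LOST along the run; after an off-skeleton birth at most ONE member older than the birth survives in any later corner — so a
re-completed FULL corner is built from ≥ 2 members born at or after the birth («FULL → off-skeleton → FULL again takes ≥ 2 steps and consumes the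
two oldest members»; the earliest re-completion is the next step, at a fixed point over the birth point). Ages = list positions: `Boundary.next`
keeps the old members' positions and appends the newest, so «members older than stage n₀» at a later stage `m` is the prefix `E_m.take |E_{n₀}|`. -/

/-- Corner size splits along any age cut. [folklore] -/
theorem cornerSize_eq_take_add_drop (E : Boundary W) (k : ℕ) (x : W) :
    cornerSize E x = cornerSize (E.take k) x + cornerSize (E.drop k) x := by
  classical
  rw [cornerSize, cornerSize, cornerSize, membersThrough, membersThrough, membersThrough]
  conv_lhs => rw [← List.take_append_drop k E]
  rw [List.filter_append, List.length_append]

/-- **ONE STEP, AGE DATUM**: the number of members older than age `k ≤ |E|` through the new point is at most the number through the image point. [folklore] -/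
theorem cornerSize_take_next_le [IsLocallyNoetherian W] (E : Boundary W) (C : W.IdealSheafData) {k : ℕ} (hk : k ≤ E.length)
    (x' : ↥(blowup C)) : cornerSize ((E.next C).take k) x' ≤ cornerSize (E.take k) ((blowup.π C).base x') := by
  rw [Boundary.take_next E C hk]
  exact cornerSize_map_strictTransform_le (E.take k) C x'

/-- **ONE σ-STEP, AGE DATUM at the marked points.** [folklore] -/
theorem CanonicalNearStepσE.cornerSize_take_le {σ : StrategyE.{u}} {N : ℕ} {ν : ℕ → ℕ} {s s' : MarkedStageE.{u}}
    (h : CanonicalNearStepσE σ N ν s s') {k : ℕ} (hk : k ≤ s.E.length) :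
    cornerSize (s'.E.take k) s'.pt ≤ cornerSize (s.E.take k) s.pt := by
  obtain ⟨C, P', hln, x', -, hπ, -, -, rfl⟩ := h
  haveI := s.ln
  have := cornerSize_take_next_le s.E C hk x'
  rw [hπ] at this
  exact this

/-- Boundaries only grow along a run. [folklore] -/
theorem ReachesσE.length_E_le {σ : StrategyE.{u}} {N : ℕ} {ν : ℕ → ℕ} {s₀ s : MarkedStageE.{u}} (h : ReachesσE σ N ν s₀ s) :
    s₀.E.length ≤ s.E.length := by
  induction h with
  | refl => exact le_rfl
  | tail _ hlast ih => rw [hlast.length_E]; omega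

/-- **ALONG A RUN, AGE DATUM**: the number of members older than `k ≤ |E(s₀)|` through the marked point never increases. [folklore] -/
theorem ReachesσE.cornerSize_take_le {σ : StrategyE.{u}} {N : ℕ} {ν : ℕ → ℕ} {s₀ s : MarkedStageE.{u}} (h : ReachesσE σ N ν s₀ s)
    {k : ℕ} (hk : k ≤ s₀.E.length) : cornerSize (s.E.take k) s.pt ≤ cornerSize (s₀.E.take k) s₀.pt := by
  induction h with
  | refl => exact le_rfl
  | tail hreach hlast ih => exact (hlast.cornerSize_take_le (hk.trans (ReachesσE.length_E_le hreach))).trans ih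

/-- **THE FORBIDDEN COMBINATION («FULL → off-skeleton → FULL consumes the two oldest»)**: if the marked point `x₁` of `s₁` lies on the newest member with
at most ONE older member through it (an off-skeleton birth), then at every later stage `t` at most one member OLDER THAN THE BIRTH passes through the
marked point; in particular a FULL corner at `t` contains at least two members born at or after the birth. [folklore] -/
theorem ReachesσE.two_le_cornerSize_drop_of_offSkeleton {σ : StrategyE.{u}} {N : ℕ} {ν : ℕ → ℕ} {s₁ t : MarkedStageE.{u}}
    (h : ReachesσE σ N ν s₁ t) (hoff : cornerSize s₁.E.dropLast s₁.pt ≤ 1) :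
    cornerSize (t.E.take (s₁.E.length - 1)) t.pt ≤ 1 ∧
      (IsFullCorner t.E t.pt → 2 ≤ cornerSize (t.E.drop (s₁.E.length - 1)) t.pt) := by
  have hk : s₁.E.length - 1 ≤ s₁.E.length := Nat.sub_le _ _
  have htake : s₁.E.take (s₁.E.length - 1) = s₁.E.dropLast := (List.dropLast_eq_take).symm
  have h1 : cornerSize (t.E.take (s₁.E.length - 1)) t.pt ≤ 1 := by
    have := h.cornerSize_take_le hk
    rw [htake] at this
    exact this.trans hoff
  refine ⟨h1, fun hfull => ?_⟩
  have hsplit := cornerSize_eq_take_add_drop t.E (s₁.E.length - 1) t.pt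
  have h3 : 3 ≤ cornerSize t.E t.pt := hfull
  omega

/-! ## §8 (appended 2026-08-27, same seat, rev 2 of this sibling; RULING v3.14-23 (GA)/(GB)(i) «(G3)»). WHERE A FULL CORNER CAN BE BORN, read on `cornerSize_next`.
(G3) as asked («points of corner size ≤ 2 keep size ≤ 2 under a boundary-stratum blow-up») does NOT hold in general; the bookkeeping truth is:
(a) over a point with `≤ 1` boundary member NO full corner is born; (b) over a PAIR point a full corner is born exactly at the points of the new member
lying on the strict transforms of BOTH old members — so it is EXCLUDED as soon as one of the two strict transforms misses the point (the case of a
centre contained in both members met transversally: faces `R ⊇ B(x)`), and it HAPPENS for a curve centre lying in only one of the two members and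
crossed transversally by the other (toric hand check, res-type-067 STATUS 2026-08-27T13:07Z: coordinates `(v_a, v_b, s)`, `E_a = (v_a)`, `E_b = (v_b)`,
`C = V(v_a, s)`; in the `s`-chart the origin is a triple point `{(s), (v_a'), (v_b)}` = the game position «`J = {a, s}`, chart `s`» over the pair point)
— a GEOMETRIC/open item for the block argument, recorded here as prose only; (c) over a full corner only children. -/

/-- **(G3′a) NO FULL CORNER IS BORN OVER A POINT WITH AT MOST ONE BOUNDARY MEMBER.** [folklore] -/
theorem not_isFullCorner_next_of_cornerSize_le_one [IsLocallyNoetherian W] {E : Boundary W} {C : W.IdealSheafData} {x' : ↥(blowup C)}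
    (h1 : cornerSize E ((blowup.π C).base x') ≤ 1) : ¬ IsFullCorner (E.next C) x' := by
  rw [isFullCorner_iff_three_le]
  have := cornerSize_next_le E C x'
  omega

/-- **(G3′b) A FULL CORNER BORN OVER A PAIR POINT lies on the new member AND on the strict transforms of BOTH old members through the image point**
(the old members through `x'` ARE the members through `π x'`). [folklore] -/
theorem oldThrough_eq_membersThrough_of_isFullCorner_next [IsLocallyNoetherian W] {E : Boundary W} {C : W.IdealSheafData} {x' : ↥(blowup C)}
    (h2 : cornerSize E ((blowup.π C).base x') ≤ 2) (hfull : IsFullCorner (E.next C) x') :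
    x' ∈ ((C.comap (blowup.π C)).support : Set ↥(blowup C)) ∧ oldThrough E C x' = membersThrough E ((blowup.π C).base x') := by
  classical
  rw [isFullCorner_iff_three_le, cornerSize_next] at hfull
  have hle := length_oldThrough_le E C x'
  rw [cornerSize] at h2 hle
  by_cases hx : x' ∈ ((C.comap (blowup.π C)).support : Set ↥(blowup C))
  · rw [if_pos hx] at hfull
    exact ⟨hx, (oldThrough_sublist E C x').eq_of_length (by omega)⟩
  · rw [if_neg hx] at hfull
    omega

/-- … so every member through the image point has its strict transform through the newborn full corner. [folklore] -/
theorem mem_support_strictTransform_of_isFullCorner_next [IsLocallyNoetherian W] {E : Boundary W} {C : W.IdealSheafData} {x' : ↥(blowup C)}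
    (h2 : cornerSize E ((blowup.π C).base x') ≤ 2) (hfull : IsFullCorner (E.next C) x') {I : W.IdealSheafData}
    (hI : I ∈ membersThrough E ((blowup.π C).base x')) :
    x' ∈ ((strictTransformIdeal (blowup.π C) C I).support : Set ↥(blowup C)) := by
  have h := (oldThrough_eq_membersThrough_of_isFullCorner_next h2 hfull).2
  rw [← h] at hI
  exact (mem_oldThrough_iff.mp hI).2

/-- **(G3′) NO FULL CORNER IS BORN OVER A POINT WITH `≤ 2` MEMBERS ONE OF WHOSE STRICT TRANSFORMS MISSES THE NEW POINT** — the by-name form the block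
argument consumes for served faces `R ⊇ B(x)` (both members contain the centre and meet transversally along it, so their strict transforms are disjoint
over the centre: at every new point one of them is missed). The `|R ∩ B(x)| = 1` crossings are NOT covered (see §8's prose). [folklore] -/
theorem no_fullCorner_birth_over_of_missed [IsLocallyNoetherian W] {E : Boundary W} {C : W.IdealSheafData} {x' : ↥(blowup C)}
    (h2 : cornerSize E ((blowup.π C).base x') ≤ 2)
    (hmiss : ∃ I ∈ membersThrough E ((blowup.π C).base x'), x' ∉ ((strictTransformIdeal (blowup.π C) C I).support : Set ↥(blowup C))) :
    ¬ IsFullCorner (E.next C) x' := by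
  intro hfull
  obtain ⟨I, hI, hx⟩ := hmiss
  exact hx (mem_support_strictTransform_of_isFullCorner_next h2 hfull hI)

/-- **(G3′) along a σ-step, at the marked point**: if `x_n` has `≤ 2` members and some member through `x_n` has its strict transform missing `x_{n+1}`, then
`x_{n+1}` is not a full corner. [folklore] -/
theorem CanonicalNearStepσE.not_isFullCorner_of_missed {σ : StrategyE.{u}} {N : ℕ} {ν : ℕ → ℕ} {s s' : MarkedStageE.{u}}
    (h : CanonicalNearStepσE σ N ν s s') (h2 : cornerSize s.E s.pt ≤ 2) :
    ∃ (C : s.W.IdealSheafData) (x' : ↥(blowup C)), (blowup.π C).base x' = s.pt ∧ HEq s'.pt x' ∧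
      ((∃ I ∈ membersThrough s.E s.pt, x' ∉ ((strictTransformIdeal (blowup.π C) C I).support : Set ↥(blowup C))) →
        ¬ IsFullCorner s'.E s'.pt) := by
  obtain ⟨C, P', hln, x', -, hπ, -, -, rfl⟩ := h
  haveI := s.ln
  refine ⟨C, x', hπ, HEq.rfl, fun hmiss => ?_⟩
  have h2' : cornerSize s.E ((blowup.π C).base x') ≤ 2 := by rw [hπ]; exact h2
  rw [← hπ] at hmiss
  exact no_fullCorner_birth_over_of_missed h2' hmiss

end Summit.ResolutionOfSingularities.ResolutionOfSingularities.Theorems.SigmaMaxModificationsCorridor3.Sigma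

end
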